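import Mathlib
import HarnessLib

/-!
# C166 `Taghizadeh2026` kit, part 1 (fields): vertex divergence of `|∇log G_{z₀}|² G_{z₀}`

D-0090 NS-CLAIMS SWEEP, refuter kit (ns-claims-refuter-1 g5), filed through a salvage seat (conv. (b)).
Generic measure theory for the refutation of the typed Lemma 4.1 of E. Taghizadeh, *Exclusion of
Singularities in the Three-Dimensional Navier–Stokes Equations* (Zenodo 18468522 v2), skeleton
`Literature/Claims/NS/Taghizadeh2026.lean`: with the UNSHIFTED backward heat kernel
`G_{z₀}(t,x) = (4πν(t₀−t))^{−3/2} exp(−‖x−x₀‖²/(4ν(t₀−t)))` (§2.4 p.4 l.80–88; vertex AT `z₀`), the weight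
`|∇log G_{z₀}|² G_{z₀} = ‖x−x₀‖²/(4ν²(t₀−t)²) · G_{z₀}` is not integrable near the vertex: on the parabolic shell
`S_T(z₀) = {t₀−T < t < t₀, ν(t₀−t)/4 ≤ ‖x−x₀‖² ≤ ν(t₀−t)}` each time slice contributes `≥ C₀/(ν(t₀−t))` and
`∫₀ dτ/τ = ∞`, so `∫⁻_{S_T} = ⊤`; consequently a real function dominating a positive multiple of the weight on
the shell is not integrable on any `Q ⊇ S_T(z₀)` and its Bochner integral is the junk value `0`. Also: the
explicit log-gradient `∇log G_{z₀}(t,·)(y) = −(y−x₀)/(2ν(t₀−t))` (the print's formula p.11 l.24–28) and the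
inclusion of the shell in the cylinder `Q_r(z₀)`. Tree convention: `z = (t, x) : ℝ × EuclideanSpace ℝ (Fin 3)`.
WHAT THIS IS NOT: not a claim about NS regularity or blow-up; not a claim about any author beyond the typed
locator. [cite: Taghizadeh2026, §2.4 p.4 l.80 – p.5 l.15; Lemma 4.1 p.10 l.71 – p.11 l.36]
-/

noncomputable section

set_option linter.dupNamespace false

namespace Summit.NavierStokesRegularity.NavierStokesRegularity.Theorems.Taghizadeh2026

namespace Vertex

open MeasureTheory Set Metric Real
open scoped ENNReal

/-- Physical space `ℝ³`. -/
abbrev E3 := EuclideanSpace ℝ (Fin 3)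

/-- Backward heat kernel with vertex at `z₀ = (t₀, x₀)`, written with `a^{3/2} = a · √a`:
`G(t,x) = exp(-‖x-x₀‖²/(4ν(t₀-t))) / ((4πν(t₀-t)) · √(4πν(t₀-t)))`. -/
def bhk (ν : ℝ) (z₀ z : ℝ × E3) : ℝ :=
  Real.exp (-(‖z.2 - z₀.2‖ ^ 2) / (4 * ν * (z₀.1 - z.1))) /
    ((4 * π * ν * (z₀.1 - z.1)) * Real.sqrt (4 * π * ν * (z₀.1 - z.1)))

/-- The model integrand `|∇ log G_{z₀}|² G_{z₀} = ‖x-x₀‖² / (4ν²(t₀-t)²) · G_{z₀}(t,x)`. -/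
def vtx (ν : ℝ) (z₀ z : ℝ × E3) : ℝ :=
  ‖z.2 - z₀.2‖ ^ 2 / (4 * ν ^ 2 * (z₀.1 - z.1) ^ 2) * bhk ν z₀ z

/-- The parabolic shell region
`S_T(z₀) = {(t,x) : t₀ - T < t < t₀, ν (t₀ - t)/4 ≤ ‖x - x₀‖² ≤ ν (t₀ - t)}` (away from the axis,
where `∇log G` vanishes, and inside `{s ≤ 1}` for `T ≤ r²/(1+ν)`). -/
def core (ν T : ℝ) (z₀ : ℝ × E3) : Set (ℝ × E3) :=
  {z | z₀.1 - T < z.1 ∧ z.1 < z₀.1 ∧ ν * (z₀.1 - z.1) / 4 ≤ ‖z.2 - z₀.2‖ ^ 2 ∧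
    ‖z.2 - z₀.2‖ ^ 2 ≤ ν * (z₀.1 - z.1)}

/-- The shell constant `C₀ = (1/16) · (1/(8π√π)) · e^{-1/4} · (7π/6) > 0`. -/
def C0 : ℝ := 1 / 16 * (1 / (8 * π * Real.sqrt π)) * Real.exp (-1 / 4) * (7 * π / 6)

/-- The shell constant is positive. -/
lemma C0_pos : 0 < C0 := by
  unfold C0; positivity

/-- The kernel is nonnegative below the vertex time. -/
lemma bhk_nonneg {ν : ℝ} (hν : 0 < ν) {z₀ z : ℝ × E3} (ht : z.1 < z₀.1) : 0 ≤ bhk ν z₀ z := by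
  unfold bhk
  have : 0 < z₀.1 - z.1 := by linarith
  positivity

/-- The model integrand is nonnegative below the vertex time. -/
lemma vtx_nonneg {ν : ℝ} (hν : 0 < ν) {z₀ z : ℝ × E3} (ht : z.1 < z₀.1) : 0 ≤ vtx ν z₀ z := by
  unfold vtx
  have := bhk_nonneg hν (z₀ := z₀) ht
  positivity

/-- The model integrand is measurable. -/
lemma measurable_vtx (ν : ℝ) (z₀ : ℝ × E3) : Measurable (vtx ν z₀) := by
  unfold vtx bhk
  fun_prop

/-- The shell region is measurable. -/
lemma measurableSet_core (ν T : ℝ) (z₀ : ℝ × E3) : MeasurableSet (core ν T z₀) := by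
  unfold core
  have h1 : Measurable fun z : ℝ × E3 => z.1 := measurable_fst
  have h2 : Measurable fun z : ℝ × E3 => ‖z.2 - z₀.2‖ ^ 2 :=
    ((measurable_snd.sub_const _).norm).pow_const _
  have h3 : Measurable fun z : ℝ × E3 => ν * (z₀.1 - z.1) :=
    (measurable_const.sub measurable_fst).const_mul _
  have h4 : Measurable fun z : ℝ × E3 => ν * (z₀.1 - z.1) / 4 := h3.div_const _
  exact (measurableSet_lt measurable_const h1).inter
    ((measurableSet_lt h1 measurable_const).inter
      ((measurableSet_le h4 h2).inter (measurableSet_le h2 h3)))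

/-- Pointwise lower bound on the shell `ρ/2 ≤ ‖x - x₀‖ ≤ ρ`, `ρ = √(ν(t₀-t))`:
`vtx ≥ (1/(16ρ²)) · (1/(8π√π ρ³)) · e^{-1/4}`. -/
lemma vtx_ge_on_shell {ν : ℝ} (hν : 0 < ν) {z₀ : ℝ × E3} {t : ℝ} (ht : t < z₀.1)
    {x : E3} (hlo : Real.sqrt (ν * (z₀.1 - t)) / 2 ≤ ‖x - z₀.2‖)
    (hhi : ‖x - z₀.2‖ ≤ Real.sqrt (ν * (z₀.1 - t))) :
    1 / (16 * (Real.sqrt (ν * (z₀.1 - t))) ^ 2) *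
        (1 / (8 * π * Real.sqrt π * (Real.sqrt (ν * (z₀.1 - t))) ^ 3)) * Real.exp (-1 / 4)
      ≤ vtx ν z₀ (t, x) := by
  set τ := z₀.1 - t with hτdef
  have hτ : 0 < τ := by simp [hτdef]; linarith
  set ρ := Real.sqrt (ν * τ) with hρdef
  have hντ : 0 < ν * τ := mul_pos hν hτ
  have hρ : 0 < ρ := Real.sqrt_pos.mpr hντ
  have hρ2 : ρ ^ 2 = ν * τ := Real.sq_sqrt hντ.le
  set d := ‖x - z₀.2‖ with hd
  have hd0 : 0 ≤ d := norm_nonneg _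
  -- rewrite vtx in terms of ρ and d
  have hsqrt : Real.sqrt (4 * π * ν * τ) = 2 * ρ * Real.sqrt π := by
    rw [show 4 * π * ν * τ = (2 * ρ) ^ 2 * π by rw [mul_pow, hρ2]; ring]
    rw [Real.sqrt_mul (by positivity), Real.sqrt_sq (by positivity)]
  have hv : vtx ν z₀ (t, x) =
      d ^ 2 / (4 * ρ ^ 4) * (Real.exp (-(d ^ 2) / (4 * ρ ^ 2)) / ((4 * π * ρ ^ 2) * (2 * ρ * Real.sqrt π))) := by
    unfold vtx bhk
    simp only
    rw [← hτdef, ← hd, hsqrt]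
    rw [show 4 * ν ^ 2 * τ ^ 2 = 4 * ρ ^ 4 by rw [show ρ ^ 4 = (ρ ^ 2) ^ 2 by ring, hρ2]; ring]
    rw [show 4 * ν * τ = 4 * ρ ^ 2 by rw [hρ2]; ring]
    rw [show 4 * π * ν * τ = 4 * π * ρ ^ 2 by rw [hρ2]; ring]
  rw [hv]
  -- factor bounds
  have h1 : 1 / (16 * ρ ^ 2) ≤ d ^ 2 / (4 * ρ ^ 4) := by
    have : (ρ / 2) ^ 2 ≤ d ^ 2 := by
      exact pow_le_pow_left₀ (by positivity) hlo 2
    rw [div_le_div_iff₀ (by positivity) (by positivity)]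
    nlinarith [this, hρ.le, pow_pos hρ 2, pow_pos hρ 4]
  have h2 : Real.exp (-1 / 4) ≤ Real.exp (-(d ^ 2) / (4 * ρ ^ 2)) := by
    apply Real.exp_le_exp.mpr
    have hd2 : d ^ 2 ≤ ρ ^ 2 := pow_le_pow_left₀ hd0 hhi 2
    rw [div_le_div_iff₀ (by norm_num) (by positivity)]
    nlinarith [hd2, pow_pos hρ 2]
  have h3 : 1 / (8 * π * Real.sqrt π * ρ ^ 3) =
      1 / ((4 * π * ρ ^ 2) * (2 * ρ * Real.sqrt π)) := by
    congr 1; ring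
  calc 1 / (16 * ρ ^ 2) * (1 / (8 * π * Real.sqrt π * ρ ^ 3)) * Real.exp (-1 / 4)
      = 1 / (16 * ρ ^ 2) * (Real.exp (-1 / 4) / ((4 * π * ρ ^ 2) * (2 * ρ * Real.sqrt π))) := by
        rw [h3]; ring
    _ ≤ d ^ 2 / (4 * ρ ^ 4) * (Real.exp (-(d ^ 2) / (4 * ρ ^ 2)) / ((4 * π * ρ ^ 2) * (2 * ρ * Real.sqrt π))) := by
        gcongr

/-- Volume of the shell `closedBall x₀ ρ \ ball x₀ (ρ/2)` in `ℝ³`: `(ρ³ - (ρ/2)³) · 4π/3`. -/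
lemma volume_shell (x₀ : E3) {ρ : ℝ} (hρ : 0 ≤ ρ) :
    volume (closedBall x₀ ρ \ ball x₀ (ρ / 2)) =
      ENNReal.ofReal ((ρ ^ 3 - (ρ / 2) ^ 3) * (π * 4 / 3)) := by
  rw [measure_sdiff (ball_subset_closedBall.trans (closedBall_subset_closedBall (by linarith)))
    measurableSet_ball.nullMeasurableSet (measure_ball_lt_top).ne]
  rw [EuclideanSpace.volume_closedBall_fin_three, EuclideanSpace.volume_ball_fin_three]
  rw [← ENNReal.ofReal_pow hρ, ← ENNReal.ofReal_pow (by positivity),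
    ← ENNReal.ofReal_mul (by positivity), ← ENNReal.ofReal_mul (by positivity),
    ← ENNReal.ofReal_sub _ (by positivity)]
  congr 1; ring

/-- Slice bound: for `t₀ - T < t < t₀`, the inner `x`-integral of the indicator of the core
region is at least `C₀ / (ν (t₀ - t))`. -/
lemma slice_bound {ν T : ℝ} (hν : 0 < ν) (z₀ : ℝ × E3) {t : ℝ} (ht : t ∈ Ioo (z₀.1 - T) z₀.1) :
    ENNReal.ofReal (C0 / (ν * (z₀.1 - t))) ≤
      ∫⁻ x, (core ν T z₀).indicator (fun z => ENNReal.ofReal (vtx ν z₀ z)) (t, x) := by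
  set τ := z₀.1 - t with hτdef
  have hτ : 0 < τ := by simp [hτdef]; linarith [ht.2]
  set ρ := Real.sqrt (ν * τ) with hρdef
  have hντ : 0 < ν * τ := mul_pos hν hτ
  have hρ : 0 < ρ := Real.sqrt_pos.mpr hντ
  have hρ2 : ρ ^ 2 = ν * τ := Real.sq_sqrt hντ.le
  set L : ℝ := 1 / (16 * ρ ^ 2) * (1 / (8 * π * Real.sqrt π * ρ ^ 3)) * Real.exp (-1 / 4) with hL
  have hL0 : 0 ≤ L := by positivity
  set A := closedBall z₀.2 ρ \ ball z₀.2 (ρ / 2) with hA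
  have hAm : MeasurableSet A := measurableSet_closedBall.diff measurableSet_ball
  -- pointwise: on A the indicator equals ofReal vtx ≥ ofReal L
  have hpt : ∀ x, A.indicator (fun _ => ENNReal.ofReal L) x ≤
      (core ν T z₀).indicator (fun z => ENNReal.ofReal (vtx ν z₀ z)) (t, x) := by
    intro x
    by_cases hx : x ∈ A
    · have hhi : ‖x - z₀.2‖ ≤ ρ := by
        have := hx.1; rw [mem_closedBall, dist_eq_norm] at this; exact this
      have hlo : ρ / 2 ≤ ‖x - z₀.2‖ := by
        have := hx.2; rw [mem_ball, dist_eq_norm, not_lt] at this; exact this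
      have hmem : ((t, x) : ℝ × E3) ∈ core ν T z₀ := by
        refine ⟨ht.1, ht.2, ?_, ?_⟩
        · simp only
          rw [← hτdef, ← hρ2]
          have h4 : (ρ / 2) ^ 2 ≤ ‖x - z₀.2‖ ^ 2 := pow_le_pow_left₀ (by positivity) hlo 2
          linarith [h4]
        · simp only
          rw [← hτdef, ← hρ2]
          exact pow_le_pow_left₀ (norm_nonneg _) hhi 2
      rw [indicator_of_mem hx, indicator_of_mem hmem]
      exact ENNReal.ofReal_le_ofReal (vtx_ge_on_shell hν ht.2 hlo hhi)
    · rw [indicator_of_notMem hx]; exact bot_le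
  calc ENNReal.ofReal (C0 / (ν * τ))
      = ENNReal.ofReal L * volume A := by
        rw [hA, volume_shell z₀.2 hρ.le, ← ENNReal.ofReal_mul hL0]
        congr 1
        rw [hL, ← hρ2, C0]
        field_simp
        ring
    _ = ∫⁻ x, A.indicator (fun _ => ENNReal.ofReal L) x := (lintegral_indicator_const hAm _).symm
    _ ≤ _ := lintegral_mono hpt

/-- `∫⁻_{(t₀-T, t₀)} ofReal (C₀/(ν (t₀ - t))) dt = ⊤` (`1/τ` is not integrable at `0`). -/
lemma lintegral_time_eq_top {ν T : ℝ} (hν : 0 < ν) (hT : 0 < T) (t₀ : ℝ) :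
    ∫⁻ t in Ioo (t₀ - T) t₀, ENNReal.ofReal (C0 / (ν * (t₀ - t))) = ⊤ := by
  have key : ∫⁻ t in Ioo (t₀ - T) t₀, ENNReal.ofReal ((t₀ - t)⁻¹) = ⊤ := by
    by_contra h
    have hint : IntegrableOn (fun t => (t₀ - t)⁻¹) (Ioo (t₀ - T) t₀) := by
      refine ⟨by fun_prop, ?_⟩
      rw [HasFiniteIntegral]
      calc ∫⁻ t in Ioo (t₀ - T) t₀, ‖(t₀ - t)⁻¹‖ₑ
          = ∫⁻ t in Ioo (t₀ - T) t₀, ENNReal.ofReal ((t₀ - t)⁻¹) := by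
            refine setLIntegral_congr_fun measurableSet_Ioo (fun t ht => ?_)
            rw [Real.enorm_eq_ofReal (inv_nonneg.mpr (by linarith [ht.2]))]
        _ < ⊤ := lt_top_iff_ne_top.mpr h
    have hii : IntervalIntegrable (fun t => (t - t₀)⁻¹) volume (t₀ - T) t₀ := by
      rw [intervalIntegrable_iff_integrableOn_Ioo_of_le (by linarith)]
      refine (hint.neg).congr_fun (fun t _ => ?_) measurableSet_Ioo
      simp only [Pi.neg_apply]
      rw [← inv_neg, neg_sub]
    rcases intervalIntegrable_sub_inv_iff.mp hii with h2 | h2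
    · linarith
    · exact h2 right_mem_uIcc
  have hc : ENNReal.ofReal (C0 / ν) ≠ 0 := by
    have := C0_pos; positivity
  calc ∫⁻ t in Ioo (t₀ - T) t₀, ENNReal.ofReal (C0 / (ν * (t₀ - t)))
      = ∫⁻ t in Ioo (t₀ - T) t₀, ENNReal.ofReal (C0 / ν) * ENNReal.ofReal ((t₀ - t)⁻¹) := by
        refine setLIntegral_congr_fun measurableSet_Ioo (fun t ht => ?_)
        rw [← ENNReal.ofReal_mul (by have := C0_pos; positivity)]
        congr 1
        field_simp
    _ = ENNReal.ofReal (C0 / ν) * ∫⁻ t in Ioo (t₀ - T) t₀, ENNReal.ofReal ((t₀ - t)⁻¹) :=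
        lintegral_const_mul' _ _ ENNReal.ofReal_ne_top
    _ = ⊤ := by rw [key, ENNReal.mul_top hc]

/-- **Vertex divergence.** `∫⁻_{S_T(z₀)} ofReal (|∇log G_{z₀}|² G_{z₀}) = ⊤` for all `ν, T > 0`. -/
theorem lintegral_vtx_core_eq_top {ν T : ℝ} (hν : 0 < ν) (hT : 0 < T) (z₀ : ℝ × E3) :
    ∫⁻ z in core ν T z₀, ENNReal.ofReal (vtx ν z₀ z) = ⊤ := by
  have hS := measurableSet_core ν T z₀
  have hF : Measurable (fun z => ENNReal.ofReal (vtx ν z₀ z)) :=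
    ENNReal.measurable_ofReal.comp (measurable_vtx ν z₀)
  rw [← lintegral_indicator hS, Measure.volume_eq_prod, lintegral_prod _ (hF.indicator hS).aemeasurable]
  refine eq_top_iff.mpr ?_
  calc (⊤ : ℝ≥0∞) = ∫⁻ t in Ioo (z₀.1 - T) z₀.1, ENNReal.ofReal (C0 / (ν * (z₀.1 - t))) :=
        (lintegral_time_eq_top hν hT z₀.1).symm
    _ = ∫⁻ t, (Ioo (z₀.1 - T) z₀.1).indicator
          (fun t => ENNReal.ofReal (C0 / (ν * (z₀.1 - t)))) t := (lintegral_indicator measurableSet_Ioo _).symm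
    _ ≤ ∫⁻ t, ∫⁻ x, (core ν T z₀).indicator (fun z => ENNReal.ofReal (vtx ν z₀ z)) (t, x) := by
        refine lintegral_mono (fun t => ?_)
        by_cases ht : t ∈ Ioo (z₀.1 - T) z₀.1
        · rw [indicator_of_mem ht]; exact slice_bound hν z₀ ht
        · rw [indicator_of_notMem ht]; exact bot_le

/-- Monotone extension: any `ℝ≥0∞`-integrand dominating `ofReal (c · vtx)` on the core region,
`c > 0`, over any larger set, has integral `⊤`. -/
theorem lintegral_eq_top_of_ge {ν T c : ℝ} (hν : 0 < ν) (hT : 0 < T) (hc : 0 < c) (z₀ : ℝ × E3)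
    {Q : Set (ℝ × E3)} (hQ : core ν T z₀ ⊆ Q) {F : ℝ × E3 → ℝ≥0∞}
    (hF : ∀ z ∈ core ν T z₀, ENNReal.ofReal (c * vtx ν z₀ z) ≤ F z) :
    ∫⁻ z in Q, F z = ⊤ := by
  refine eq_top_iff.mpr ?_
  calc (⊤ : ℝ≥0∞) = ENNReal.ofReal c * ∫⁻ z in core ν T z₀, ENNReal.ofReal (vtx ν z₀ z) := by
        rw [lintegral_vtx_core_eq_top hν hT z₀, ENNReal.mul_top (by positivity)]
    _ = ∫⁻ z in core ν T z₀, ENNReal.ofReal (c * vtx ν z₀ z) := by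
        rw [← lintegral_const_mul' _ _ ENNReal.ofReal_ne_top]
        refine setLIntegral_congr_fun (measurableSet_core ν T z₀) (fun z hz => ?_)
        rw [ENNReal.ofReal_mul hc.le]
    _ ≤ ∫⁻ z in core ν T z₀, F z := by
        refine lintegral_mono_ae ?_
        exact (ae_restrict_iff' (measurableSet_core ν T z₀)).mpr (ae_of_all _ hF)
    _ ≤ ∫⁻ z in Q, F z := lintegral_mono_set hQ

/-- Non-integrability corollary (Bochner side): a real integrand `g ≥ c · vtx` on the core region
is not integrable on any `Q ⊇ S_T(z₀)`; hence its Bochner integral over `Q` is the junk value `0`. -/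
theorem not_integrableOn_of_ge {ν T c : ℝ} (hν : 0 < ν) (hT : 0 < T) (hc : 0 < c) (z₀ : ℝ × E3)
    {Q : Set (ℝ × E3)} (hQ : core ν T z₀ ⊆ Q) {g : ℝ × E3 → ℝ}
    (hg : ∀ z ∈ core ν T z₀, c * vtx ν z₀ z ≤ g z) :
    ¬ IntegrableOn g Q volume := by
  intro hint
  have htop : ∫⁻ z in Q, ‖g z‖ₑ = ⊤ := by
    refine lintegral_eq_top_of_ge hν hT hc z₀ hQ (fun z hz => ?_)
    calc ENNReal.ofReal (c * vtx ν z₀ z) ≤ ENNReal.ofReal (g z) := ENNReal.ofReal_le_ofReal (hg z hz)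
      _ ≤ ENNReal.ofReal |g z| := ENNReal.ofReal_le_ofReal (le_abs_self _)
      _ = ‖g z‖ₑ := (Real.enorm_eq_ofReal_abs _).symm
  exact (lt_top_iff_ne_top.mp hint.hasFiniteIntegral) htop

/-- Bochner junk: a real function dominating `c · vtx` on the shell has integral `0` over any
`Q ⊇` shell (it is not integrable there). -/
theorem integral_eq_zero_of_ge {ν T c : ℝ} (hν : 0 < ν) (hT : 0 < T) (hc : 0 < c) (z₀ : ℝ × E3)
    {Q : Set (ℝ × E3)} (hQ : core ν T z₀ ⊆ Q) {g : ℝ × E3 → ℝ}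
    (hg : ∀ z ∈ core ν T z₀, c * vtx ν z₀ z ≤ g z) :
    ∫ z in Q, g z = 0 :=
  integral_undef (not_integrableOn_of_ge hν hT hc z₀ hQ hg)

/-- The core region sits inside the tree's backward parabolic cylinder `Q_r(z₀)` as soon as
`T ≤ r²` and `ν T < r²`… we record the elementary inclusion in the form needed:
for `z ∈ S_T(z₀)` with `T ≤ r ^ 2 / (1 + ν)`: `t₀ - r² < t < t₀`, `‖x - x₀‖ < r`, and the
normalised parabolic distance `s = (‖x-x₀‖² + (t₀ - t))/r² ≤ 1`. -/
lemma core_bounds {ν T r : ℝ} (hν : 0 < ν) (hr : 0 < r) (hT : T ≤ r ^ 2 / (1 + ν))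
    {z₀ z : ℝ × E3} (hz : z ∈ core ν T z₀) :
    z₀.1 - r ^ 2 < z.1 ∧ z.1 < z₀.1 ∧ ‖z.2 - z₀.2‖ < r ∧
      ‖z.2 - z₀.2‖ ^ 2 + (z₀.1 - z.1) ≤ r ^ 2 := by
  obtain ⟨h1, h2, -, h3⟩ := hz
  have hτ : 0 < z₀.1 - z.1 := by linarith
  have hTle : T ≤ r ^ 2 := by
    have : r ^ 2 / (1 + ν) ≤ r ^ 2 := div_le_self (by positivity) (by linarith)
    linarith
  have hτT : z₀.1 - z.1 < T := by linarith
  have hsum : ‖z.2 - z₀.2‖ ^ 2 + (z₀.1 - z.1) ≤ r ^ 2 := by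
    have : (1 + ν) * (z₀.1 - z.1) ≤ r ^ 2 := by
      have h' : (z₀.1 - z.1) ≤ r ^ 2 / (1 + ν) := by linarith
      have := (le_div_iff₀ (by positivity : (0:ℝ) < 1 + ν)).mp h'
      linarith [this]
    nlinarith [h3, this]
  refine ⟨by linarith, h2, ?_, hsum⟩
  have hlt : ‖z.2 - z₀.2‖ ^ 2 < r ^ 2 := by nlinarith [hsum, hτ]
  by_contra h
  rw [not_lt] at h
  nlinarith [h, norm_nonneg (z.2 - z₀.2), hr]

/-! ### The log-gradient of the backward heat kernel: `∇ log G_{z₀}(t,·)(y) = -(y - x₀)/(2ν(t₀-t))` -/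

/-- The kernel is positive below the vertex time. -/
lemma bhk_pos {ν : ℝ} (hν : 0 < ν) {z₀ : ℝ × E3} {t : ℝ} (ht : t < z₀.1) (x : E3) :
    0 < bhk ν z₀ (t, x) := by
  unfold bhk
  have : 0 < z₀.1 - t := by linarith
  positivity

/-- Closed form of `log G_{z₀}(t,·)`. -/
lemma log_bhk_eq {ν : ℝ} (hν : 0 < ν) {z₀ : ℝ × E3} {t : ℝ} (ht : t < z₀.1) (x : E3) :
    Real.log (bhk ν z₀ (t, x)) =
      (-(1 / (4 * ν * (z₀.1 - t)))) * ‖x - z₀.2‖ ^ 2 -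
        Real.log ((4 * π * ν * (z₀.1 - t)) * Real.sqrt (4 * π * ν * (z₀.1 - t))) := by
  have hτ : 0 < z₀.1 - t := by linarith
  unfold bhk
  simp only
  rw [Real.log_div (Real.exp_pos _).ne' (by positivity), Real.log_exp]
  ring

/-- `toDual v = innerSL v` on `ℝ³`. -/
lemma toDual_eq_innerSL (v : E3) : (InnerProductSpace.toDual ℝ E3) v = innerSL ℝ v := by
  ext w
  simp [InnerProductSpace.toDual_apply_apply, innerSL_apply_apply]

/-- `HasGradientAt (log G_{z₀}(t,·)) (-(1/(2ν(t₀-t))) • (y - x₀)) y` for `t < t₀`. -/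
theorem hasGradientAt_log_bhk {ν : ℝ} (hν : 0 < ν) {z₀ : ℝ × E3} {t : ℝ} (ht : t < z₀.1) (y : E3) :
    HasGradientAt (fun x => Real.log (bhk ν z₀ (t, x)))
      ((-(1 / (2 * ν * (z₀.1 - t)))) • (y - z₀.2)) y := by
  have hτ : 0 < z₀.1 - t := by linarith
  -- the function in closed form
  have hfun : (fun x => Real.log (bhk ν z₀ (t, x))) = fun x =>
      (-(1 / (4 * ν * (z₀.1 - t)))) * ‖x - z₀.2‖ ^ 2 -
        Real.log ((4 * π * ν * (z₀.1 - t)) * Real.sqrt (4 * π * ν * (z₀.1 - t))) := by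
    funext x; exact log_bhk_eq hν ht x
  rw [hfun]
  -- derivative of the squared distance
  have h1 : HasFDerivAt (fun x : E3 => ‖x - z₀.2‖ ^ 2) (2 • innerSL ℝ (y - z₀.2)) y := by
    have h := ((hasFDerivAt_id y).sub_const z₀.2).norm_sq
    simpa using h
  have h2 : HasFDerivAt (fun x : E3 => (-(1 / (4 * ν * (z₀.1 - t)))) * ‖x - z₀.2‖ ^ 2 -
        Real.log ((4 * π * ν * (z₀.1 - t)) * Real.sqrt (4 * π * ν * (z₀.1 - t))))
      ((-(1 / (4 * ν * (z₀.1 - t)))) • (2 • innerSL ℝ (y - z₀.2))) y :=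
    (h1.const_mul _).sub_const _
  rw [hasGradientAt_iff_hasFDerivAt]
  refine h2.congr_fderiv ?_
  rw [map_smul, toDual_eq_innerSL]
  ext w
  have hτ0 : (z₀.1 - t) ≠ 0 := hτ.ne'
  have hν0 : ν ≠ 0 := hν.ne'
  simp [innerSL_apply_apply]
  ring

end Vertex

end Summit.NavierStokesRegularity.NavierStokesRegularity.Theorems.Taghizadeh2026

end
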